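import Mathlib
import Literature.Analysis.FluidPDE.HardSphereCollisionRecord
import Literature.Analysis.FluidPDE.HardSpherePreCollisionSigma
import Literature.Analysis.FluidPDE.HardSphereRegularGeometry
import HarnessLib

/-!
# `OneFlightGossipEngine.OneFlightLayeredChaos` — kinematics of the `n`-th collision record on the good set
(crux stmt-AtomisticToContinuum-14535, line `Sketch`, registered stub `stub_record_geometry`)

Along a hard-sphere flow on `𝕋^d` (diameter `0 < ε < 1/2`), on the good set and on the window event "particle `i` has at
least `n + 1` collisions in `(0, w]`", the `n`-th collision record of `i` (`HardSphereFlow.nthRecordOf`) is a genuine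
contact record: unit impact vector, unit incoming direction, incoming pair, and the outgoing direction is the specular
image of the incoming one. Route: the window count makes the `n`-th collision time genuine
(`HardSphereFlow.le_encard_collisionTimesOf_of_le_ncard`, `IsHardSphereTrajectory.nthCollisionTimeOf_enum_of_encard`),
so `i` collides with its partner (`collide_partner`); the torus geometry is regular for `ε < 1/2`
(`Torus.isHardSphereRegular_geometry`, `swap_mem_contactPairs_iff`), so `(i, partner)` is an ordered contact pair, the
recorded pre-collisional velocities are incoming (`IsHardSphereTrajectory.inner_sepVec_preVel_neg`), and the rest is
the algebra of one specular reflection (`specular_unit_kinematics`). No new definitions.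
-/

open MeasureTheory Set Filter Topology
open Literature.Analysis.FluidPDE

namespace Summit.AtomisticToContinuum.HydrodynamicLimit.Theorems

/-- Reflecting a vector `g` across the hyperplane orthogonal to `nvec` preserves its norm:
`‖g - 2 (⟪g, n⟫ / ‖n‖²) n‖ = ‖g‖`. [folklore] -/
theorem norm_sub_two_mul_div_smul {E : Type*} [NormedAddCommGroup E] [InnerProductSpace ℝ E]
    (g nvec : E) : ‖g - (2 * (inner ℝ g nvec / ‖nvec‖ ^ 2)) • nvec‖ = ‖g‖ := by
  by_cases hn : nvec = 0
  · simp [hn]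
  have hn' : ‖nvec‖ ^ 2 ≠ 0 := pow_ne_zero 2 (norm_ne_zero_iff.2 hn)
  have h : ‖g - (2 * (inner ℝ g nvec / ‖nvec‖ ^ 2)) • nvec‖ ^ 2 = ‖g‖ ^ 2 := by
    rw [norm_sub_sq_real, norm_smul, inner_smul_right, mul_pow, Real.norm_eq_abs, sq_abs]
    field_simp
    ring
  exact (sq_eq_sq₀ (norm_nonneg _) (norm_nonneg _)).1 h

/-- **Specular kinematics of one contact.** For a contact normal `nvec` of length `ε > 0` and an
incoming relative velocity `g` (`⟪nvec, g⟫ < 0`), with `ω = ε⁻¹ nvec`, `ĝ = g/‖g‖` and the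
outgoing relative velocity `g' = g - 2 (⟪g, nvec⟫/‖nvec‖²) nvec`: `‖ω‖ = 1`, `‖ĝ‖ = 1`,
`⟪ω, ĝ⟫ < 0` and `g'/‖g'‖ = ĝ - 2 ⟪ω, ĝ⟫ ω`. [folklore] -/
theorem specular_unit_kinematics {E : Type*} [NormedAddCommGroup E] [InnerProductSpace ℝ E]
    {ε : ℝ} (hε : 0 < ε) {nvec g : E} (hn : ‖nvec‖ = ε) (hin : inner ℝ nvec g < 0) :
    ‖ε⁻¹ • nvec‖ = 1 ∧ ‖‖g‖⁻¹ • g‖ = 1 ∧ inner ℝ (ε⁻¹ • nvec) (‖g‖⁻¹ • g) < 0 ∧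
      ‖g - (2 * (inner ℝ g nvec / ‖nvec‖ ^ 2)) • nvec‖⁻¹ •
          (g - (2 * (inner ℝ g nvec / ‖nvec‖ ^ 2)) • nvec) =
        ‖g‖⁻¹ • g - (2 * inner ℝ (ε⁻¹ • nvec) (‖g‖⁻¹ • g)) • (ε⁻¹ • nvec) := by
  have hg : g ≠ 0 := by
    rintro rfl
    rw [inner_zero_right] at hin
    exact lt_irrefl _ hin
  have hgn : ‖g‖ ≠ 0 := norm_ne_zero_iff.2 hg
  have hgpos : 0 < ‖g‖ := norm_pos_iff.2 hg
  refine ⟨?_, ?_, ?_, ?_⟩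
  · rw [norm_smul, norm_inv, Real.norm_of_nonneg hε.le, hn, inv_mul_cancel₀ hε.ne']
  · rw [norm_smul, norm_inv, norm_norm, inv_mul_cancel₀ hgn]
  · rw [real_inner_smul_left, real_inner_smul_right]
    exact mul_neg_of_pos_of_neg (inv_pos.2 hε) (mul_neg_of_pos_of_neg (inv_pos.2 hgpos) hin)
  · rw [norm_sub_two_mul_div_smul, real_inner_smul_left, real_inner_smul_right, hn, smul_sub,
      smul_smul, smul_smul, real_inner_comm g nvec]
    congr 2
    field_simp

/-- **Kinematics of a contact record.** At a contact of the ordered pair `(i, j)` (`‖x_i - x_j‖ = ε`,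
`0 < ε`) whose recorded pre-collisional velocities are incoming (`⟪x_i - x_j, v_i⁻ - v_j⁻⟫ < 0`),
the record `c = ofConfig G ε z t i j` has unit impact vector, unit incoming direction,
`⟪c.impactVec, c.inDir⟫ < 0`, and its outgoing direction is the specular image
`c.outDir = c.inDir - 2 ⟪c.impactVec, c.inDir⟫ c.impactVec`. [folklore] -/
theorem ofConfig_record_geometry {d X : Type*} [Fintype d] {N : ℕ} {G : Geometry d X} {ε : ℝ}
    (hε : 0 < ε) {z : Config N d X} (t : ℝ) {i j : Fin N} (hc : z ∈ contactSet G N ε i j)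
    (hin : inner ℝ (G.sepVec (z i).1 (z j).1)
      ((HardSphereCollisionRecord.ofConfig G ε z t i j).preVel.1 -
        (HardSphereCollisionRecord.ofConfig G ε z t i j).preVel.2) < 0) :
    ‖(HardSphereCollisionRecord.ofConfig G ε z t i j).impactVec‖ = 1 ∧
      ‖(HardSphereCollisionRecord.ofConfig G ε z t i j).inDir‖ = 1 ∧
      inner ℝ (HardSphereCollisionRecord.ofConfig G ε z t i j).impactVec
        (HardSphereCollisionRecord.ofConfig G ε z t i j).inDir < 0 ∧
      (HardSphereCollisionRecord.ofConfig G ε z t i j).outDir =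
        (HardSphereCollisionRecord.ofConfig G ε z t i j).inDir -
          (2 * inner ℝ (HardSphereCollisionRecord.ofConfig G ε z t i j).impactVec
            (HardSphereCollisionRecord.ofConfig G ε z t i j).inDir) •
            (HardSphereCollisionRecord.ofConfig G ε z t i j).impactVec := by
  have hnorm : ‖G.sepVec (z i).1 (z j).1‖ = ε := (mem_contactSet.1 hc).2
  have hpost : (HardSphereCollisionRecord.ofConfig G ε z t i j).postVel.1 -
      (HardSphereCollisionRecord.ofConfig G ε z t i j).postVel.2 =
      ((HardSphereCollisionRecord.ofConfig G ε z t i j).preVel.1 -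
        (HardSphereCollisionRecord.ofConfig G ε z t i j).preVel.2) -
        (2 * (inner ℝ ((HardSphereCollisionRecord.ofConfig G ε z t i j).preVel.1 -
          (HardSphereCollisionRecord.ofConfig G ε z t i j).preVel.2) (G.sepVec (z i).1 (z j).1) /
            ‖G.sepVec (z i).1 (z j).1‖ ^ 2)) • G.sepVec (z i).1 (z j).1 := by
    have hinv : (HardSphereCollisionRecord.ofConfig G ε z t i j).postVel =
        reflectVel (G.sepVec (z i).1 (z j).1) (HardSphereCollisionRecord.ofConfig G ε z t i j).preVel := by
      rw [HardSphereCollisionRecord.ofConfig_preVel, HardSphereCollisionRecord.ofConfig_postVel,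
        reflectVel_reflectVel]
    rw [hinv]
    simp only [reflectVel, mul_smul, two_smul]
    abel
  obtain ⟨h1, h2, h3, h4⟩ := specular_unit_kinematics hε hnorm hin
  refine ⟨h1, h2, h3, ?_⟩
  rw [HardSphereCollisionRecord.outDir, HardSphereCollisionRecord.inDir, hpost,
    HardSphereCollisionRecord.ofConfig_impactVec]
  exact h4

/-- **Kinematics of the `n`-th collision record** (registered stub `stub_record_geometry` of crux
stmt-AtomisticToContinuum-14535): on `Φ.good` and on the window event, with `c = Φ.nthRecordOf i n z`:
`‖c.impactVec‖ = 1`, `‖c.inDir‖ = 1`, `⟪c.impactVec, c.inDir⟫ < 0` and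
`c.outDir = c.inDir − 2⟪c.impactVec, c.inDir⟫ • c.impactVec`. [folklore] -/
theorem stub_record_geometry {d : Type*} [Fintype d] {N : ℕ} {ε : ℝ} (hε : 0 < ε) (hε2 : ε < 2⁻¹)
    (Φ : HardSphereFlow (Torus.geometry d) ε N) (i : Fin N) (n : ℕ) (w : ℝ)
    {z : Config N d (UnitAddTorus d)} (hz : z ∈ Φ.good)
    (hW : n + 1 ≤ Set.ncard (collisionTimesOf (Torus.geometry d) ε (fun t => Φ.flow t z) i ∩ Set.Ioc 0 w)) :
    ‖(Φ.nthRecordOf i n z).impactVec‖ = 1 ∧ ‖(Φ.nthRecordOf i n z).inDir‖ = 1 ∧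
      inner ℝ (Φ.nthRecordOf i n z).impactVec (Φ.nthRecordOf i n z).inDir < 0 ∧
      (Φ.nthRecordOf i n z).outDir = (Φ.nthRecordOf i n z).inDir -
        (2 * inner ℝ (Φ.nthRecordOf i n z).impactVec (Φ.nthRecordOf i n z).inDir) •
          (Φ.nthRecordOf i n z).impactVec := by
  have hn := Φ.le_encard_collisionTimesOf_of_le_ncard hW
  have htraj := Φ.isTrajectory z hz
  obtain ⟨hmem, -, -⟩ := htraj.nthCollisionTimeOf_enum_of_encard hn
  have hpart : Participates (Torus.geometry d) ε (Φ.flow (Φ.nthCollisionTimeOf i n z) z) i :=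
    (hmem n le_rfl).1
  have hG := Torus.isHardSphereRegular_geometry (d := d) hε2
  have hp : (i, Φ.nthPartnerOf i n z) ∈
      contactPairs (Torus.geometry d) ε (Φ.flow (Φ.nthCollisionTimeOf i n z) z) := by
    rcases collide_partner hpart with h1 | h2
    · exact h1
    · exact (swap_mem_contactPairs_iff hG (p := (i, Φ.nthPartnerOf i n z))).1 h2
  have hin := htraj.inner_sepVec_preVel_neg (t := Φ.nthCollisionTimeOf i n z) hp
  exact ofConfig_record_geometry hε _ (mem_contactPairs.1 hp).2 hin

end Summit.AtomisticToContinuum.HydrodynamicLimit.Theorems
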